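import Mathlib
import HarnessLib.Audit
import Summits.PneNP.PneNP.Theorems.PstarSwitchSplitTools

/-!
# Fibres of a variable split: each side of an XOR-disconnected terminal core is fibre-terminal at every member (ROUND-24, O1; all core sizes; memo g25 §41.1/§48)

FRONTIER range-avoidance ladder, rung F-N3, ROUND 24 (cell `pnp-ideate`, prover-2 memo `g25/O1-XORSPLIT-g25.md` §41.1, §48; typed targets
`PstarCoreBoundTargets.TerminalFive` / `TerminalPeelable` (p646951); restricted-model proof complexity — nothing here bears on `P` versus `NP`).

The general coupled case of an XOR-disconnected terminal core `K = A ∪ B` split by a variable set `P` (all variables of `A` in `P`, none of `B`;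
the reader monomials may straddle `P` arbitrarily).  On the FIBRE of an assignment `w` (the variables off `P` frozen at `w`) the readers become
G-constraints on `P`:
* `litSetAt I P G w` — the `P`-literals that are the `P`-endpoint of an odd number of straddling monomials of `G` whose other endpoint is TRUE at `w`;
* `gval_piecewise` — `gval C G (P.piecewise z w) = gval C|P G|P z ⊕ gval C|Pᶜ G|Pᶜ w ⊕ parity(litSetAt w) z`; `gval_fibre` — the fibre reader
  `(C|P ∆ litSetAt w, G|P)` as one G-constraint.
* **`fibre_terminal`** (the ROW LEMMA, unconditional): for every member `e` of `A`, at the fibre of its (M0)-witness `w` the side `A` with the two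
  fibre readers satisfies (T3), (M0) for `e` (witnessed by `w` itself), and each of the three non-trivial combinations of the fibre readers ATTAINS
  its target value on `Sol(A)` (so the value set on `Sol(A)` is exactly the three non-target points) — `A` is "row-terminal" at `e`.  Inside the
  induction the minimal unsolvable subfamily through `e` folds to a terminal core with at most five members for the fibre readers: every member of
  each side lies in a small fibre certificate (memo §41.1).
-/

set_option linter.dupNamespace false -- `Summit.PneNP.PneNP.…`: summit = sub-problem name (D-0017 single-conjunct layout)

open Finset Literature.Computability.Complexity
open scoped symmDiff
open Summit.PneNP.PneNP.Theorems.PstarFibrePolys (bit bit_injective bit_xor bit_and)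
open Summit.PneNP.PneNP.Theorems.PstarPDT (parity)
open Summit.PneNP.PneNP.Theorems.PstarGraphQuadGapOne (bit_parity)
open Summit.PneNP.PneNP.Theorems.PstarTyped (Typed)
open Summit.PneNP.PneNP.Theorems.PstarSALevel (varSet bdry BoundaryExpanding SimpleOverlap)
open Summit.PneNP.PneNP.Theorems.PstarGapPeeling (eval_pure)
open Summit.PneNP.PneNP.Theorems.PstarGapOneAll (gval gval_empty)
open Summit.PneNP.PneNP.Theorems.PstarGConstraint (bit_gval)
open Summit.PneNP.PneNP.Theorems.PstarGSystemFreeVar (gval_symmDiff)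
open Summit.PneNP.PneNP.Theorems.PstarCoreBoundTargets (Terminal)
open Summit.PneNP.PneNP.Theorems.PstarChordReadFibre (symmDiff_subset_union')
open Summit.PneNP.PneNP.Theorems.PstarAdditiveSplit (gval_ne_of_ne_on_sol eval_congr gval_congr)
open Summit.PneNP.PneNP.Theorems.PstarSwitchSplitTools (gin gout gin_subset gout_subset bool_eq_of_ne_not)

namespace Summit.PneNP.PneNP.Theorems.PstarSplitFibre

variable {n m : ℕ}

/-! ## The fibre readers -/

/-- The `P`-literals gated, an odd number of times, to an outside variable that is TRUE at `w`. -/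
def litSetAt (I : LocalMap 4 n m) (P : Finset (Fin n)) (G : Finset (Fin m)) (w : Fin n → Bool) : Finset (Fin n) :=
  P.filter fun p => Odd ((G.filter fun g => ¬ (I.vars g 2 ∈ P ↔ I.vars g 3 ∈ P) ∧
    (if I.vars g 2 ∈ P then I.vars g 2 else I.vars g 3) = p ∧ w (if I.vars g 2 ∈ P then I.vars g 3 else I.vars g 2) = true).card)

/-- `litSetAt ⊆ P`. -/
theorem litSetAt_subset (I : LocalMap 4 n m) (P : Finset (Fin n)) (G : Finset (Fin m)) (w : Fin n → Bool) : litSetAt I P G w ⊆ P :=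
  filter_subset _ _

/-- **A reader at a glued point**: `gval C G (P.piecewise z w) = gval C|P G|P z ⊕ gval C|Pᶜ G|Pᶜ w ⊕ parity(litSetAt w) z`. -/
theorem gval_piecewise (I : LocalMap 4 n m) (P C : Finset (Fin n)) (G : Finset (Fin m)) (z w : Fin n → Bool) :
    gval I C G (P.piecewise z w) = xor (xor (gval I (C.filter (· ∈ P)) (gin I P G) z) (gval I (C.filter (· ∉ P)) (gout I P G) w))
      (parity (litSetAt I P G w) z) := by
  classical
  apply bit_injective
  set x := P.piecewise z w with hx
  have hxP : ∀ v ∈ P, x v = z v := fun v hv => Finset.piecewise_eq_of_mem _ _ _ hv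
  have hxQ : ∀ v ∉ P, x v = w v := fun v hv => Finset.piecewise_eq_of_notMem _ _ _ hv
  set str := G.filter fun g => ¬ (I.vars g 2 ∈ P ↔ I.vars g 3 ∈ P) with hstr
  set pv : Fin m → Fin n := fun g => if I.vars g 2 ∈ P then I.vars g 2 else I.vars g 3 with hpv
  set qv : Fin m → Fin n := fun g => if I.vars g 2 ∈ P then I.vars g 3 else I.vars g 2 with hqv
  -- the linear part
  have hC : ∑ v ∈ C, bit (x v) = ∑ v ∈ C.filter (· ∈ P), bit (z v) + ∑ v ∈ C.filter (· ∉ P), bit (w v) := by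
    rw [← sum_filter_add_sum_filter_not C (· ∈ P)]
    congr 1
    · exact sum_congr rfl fun v hv => by rw [hxP v (mem_filter.1 hv).2]
    · exact sum_congr rfl fun v hv => by rw [hxQ v (mem_filter.1 hv).2]
  -- the monomials: inside, outside, straddling
  have hGsplit : ∑ g ∈ G, bit (x (I.vars g 2)) * bit (x (I.vars g 3)) =
      ∑ g ∈ gin I P G, bit (z (I.vars g 2)) * bit (z (I.vars g 3)) +
        (∑ g ∈ gout I P G, bit (w (I.vars g 2)) * bit (w (I.vars g 3)) + ∑ g ∈ str, bit (x (I.vars g 2)) * bit (x (I.vars g 3))) := by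
    rw [← sum_filter_add_sum_filter_not G (fun g => I.vars g 2 ∈ P ∧ I.vars g 3 ∈ P)]
    unfold gin
    congr 1
    · exact sum_congr rfl fun g hg => by
        obtain ⟨-, h2, h3⟩ := mem_filter.1 hg
        rw [hxP _ h2, hxP _ h3]
    rw [← sum_filter_add_sum_filter_not (G.filter fun g => ¬ (I.vars g 2 ∈ P ∧ I.vars g 3 ∈ P)) (fun g => I.vars g 2 ∉ P ∧ I.vars g 3 ∉ P)]
    rw [filter_filter, filter_filter]
    unfold gout
    congr 1
    · have hset : (G.filter fun g => ¬ (I.vars g 2 ∈ P ∧ I.vars g 3 ∈ P) ∧ (I.vars g 2 ∉ P ∧ I.vars g 3 ∉ P)) =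
          G.filter fun g => I.vars g 2 ∉ P ∧ I.vars g 3 ∉ P := filter_congr fun g _ => by tauto
      rw [hset]
      exact sum_congr rfl fun g hg => by
        obtain ⟨-, h2, h3⟩ := mem_filter.1 hg
        rw [hxQ _ h2, hxQ _ h3]
    · rw [hstr]
      exact sum_congr (filter_congr fun g _ => by tauto) fun _ _ => rfl
  have hstrP : ∀ g ∈ str, pv g ∈ P := by
    intro g hg
    obtain ⟨-, hne⟩ := mem_filter.1 hg
    change (if I.vars g 2 ∈ P then I.vars g 2 else I.vars g 3) ∈ P
    by_cases h2 : I.vars g 2 ∈ P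
    · rw [if_pos h2]; exact h2
    · rw [if_neg h2]; by_contra h3; exact hne ⟨fun h => absurd h h2, fun h => absurd h h3⟩
  have hprod : ∀ g ∈ str, bit (x (I.vars g 2)) * bit (x (I.vars g 3)) = bit (z (pv g)) * bit (w (qv g)) := by
    intro g hg
    obtain ⟨-, hne⟩ := mem_filter.1 hg
    change _ = bit (z (if I.vars g 2 ∈ P then I.vars g 2 else I.vars g 3)) * bit (w (if I.vars g 2 ∈ P then I.vars g 3 else I.vars g 2))
    by_cases h2 : I.vars g 2 ∈ P
    · have h3 : I.vars g 3 ∉ P := fun h3 => hne ⟨fun _ => h3, fun _ => h2⟩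
      rw [if_pos h2, if_pos h2, hxP _ h2, hxQ _ h3]
    · have h3 : I.vars g 3 ∈ P := by by_contra h3; exact hne ⟨fun h => absurd h h2, fun h => absurd h h3⟩
      rw [if_neg h2, if_neg h2, hxQ _ h2, hxP _ h3, mul_comm]
  -- straddlers with a TRUE outside endpoint contribute `z (pv g)`, the others nothing
  set strT := str.filter fun g => w (qv g) = true with hstrT
  have hstrSum : ∑ g ∈ str, bit (x (I.vars g 2)) * bit (x (I.vars g 3)) = bit (parity (litSetAt I P G w) z) := by
    rw [sum_congr rfl hprod, ← sum_filter_add_sum_filter_not str (fun g => w (qv g) = true)]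
    have h0 : ∑ g ∈ str.filter (fun g => ¬ w (qv g) = true), bit (z (pv g)) * bit (w (qv g)) = 0 := by
      refine sum_eq_zero fun g hg => ?_
      have hf : w (qv g) = false := by have := (mem_filter.1 hg).2; revert this; cases w (qv g) <;> simp
      rw [hf]; simp [bit]
    have h1 : ∑ g ∈ strT, bit (z (pv g)) * bit (w (qv g)) = ∑ g ∈ strT, bit (z (pv g)) := by
      refine sum_congr rfl fun g hg => ?_
      rw [(mem_filter.1 hg).2]; simp [bit]
    rw [h0, add_zero, h1, bit_parity]
    have hstrTP : ∀ g ∈ strT, pv g ∈ P := fun g hg => hstrP g (mem_filter.1 hg).1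
    rw [← sum_fiberwise_of_maps_to' (s := strT) (t := P) (g := pv) hstrTP (fun p => bit (z p))]
    unfold litSetAt
    rw [sum_filter]
    refine sum_congr rfl fun p _ => ?_
    rw [sum_const, nsmul_eq_mul]
    have hset : (strT.filter fun g => pv g = p) = G.filter fun g => ¬ (I.vars g 2 ∈ P ↔ I.vars g 3 ∈ P) ∧
        (if I.vars g 2 ∈ P then I.vars g 2 else I.vars g 3) = p ∧ w (if I.vars g 2 ∈ P then I.vars g 3 else I.vars g 2) = true := by
      rw [hstrT, hstr, filter_filter, filter_filter]
      exact filter_congr fun g _ => by tauto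
    rw [hset]
    by_cases ho : Odd ((G.filter fun g => ¬ (I.vars g 2 ∈ P ↔ I.vars g 3 ∈ P) ∧
        (if I.vars g 2 ∈ P then I.vars g 2 else I.vars g 3) = p ∧ w (if I.vars g 2 ∈ P then I.vars g 3 else I.vars g 2) = true).card)
    · rw [if_pos ho, (ZMod.natCast_eq_one_iff_odd).2 ho, one_mul]
    · rw [if_neg ho, (ZMod.natCast_eq_zero_iff_even).2 (Nat.not_odd_iff_even.1 ho), zero_mul]
  rw [bit_xor, bit_xor, bit_gval, bit_gval, bit_gval, hC, hGsplit, hstrSum]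
  ring

/-- **The fibre reader as one G-constraint**: `gval (C|P ∆ litSetAt w) G|P z = gval C|P G|P z ⊕ parity(litSetAt w) z`. -/
theorem gval_fibre (I : LocalMap 4 n m) (P C : Finset (Fin n)) (G : Finset (Fin m)) (w z : Fin n → Bool) :
    gval I ((C.filter (· ∈ P)) ∆ litSetAt I P G w) (gin I P G) z = xor (gval I (C.filter (· ∈ P)) (gin I P G) z) (parity (litSetAt I P G w) z) := by
  have h := gval_symmDiff I (C.filter (· ∈ P)) (litSetAt I P G w) (gin I P G) ∅ z
  have e : gin I P G ∆ (∅ : Finset (Fin m)) = gin I P G := symmDiff_bot _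
  rw [e] at h
  rw [h, gval_empty]

/-! ## The row lemma -/

variable {I : LocalMap 4 n m} {r : ℕ} {y : Fin m → Bool} {K : Finset (Fin m)} {w₁ w₂ : Finset (Fin n) × Finset (Fin m) × Bool}

/-- **THE ROW LEMMA: each side of a split terminal core is fibre-terminal at every member** (all core sizes, unconditional; the straddling monomials
are arbitrary).  For `e ∈ A` let `w` be its (M0)-witness; with the fibre readers `Dᵢ = ((Cᵢ|P) ∆ litSetAt w, Gᵢ|P)` and targets
`βᵢ = bᵢ ⊕ gval Cᵢ|Pᶜ Gᵢ|Pᶜ w`: `w` solves `B` and `A ∖ e` and is on target for `D`; no solution of `A` is on target for `D` (glue it with `w`);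
and each of `D₁`, `D₂`, `D₁ ⊕ D₂` attains its target on `Sol(A)` (Lemma S over `A`). -/
theorem fibre_terminal (hI : I.IsPure xorAndPred) (hT : Typed I) (hS : SimpleOverlap I) (hB : BoundaryExpanding r I)
    (ht : Terminal I r y K w₁ w₂) {A B : Finset (Fin m)} (hAB : A ∪ B = K)
    (P : Finset (Fin n)) (hAP : ∀ j ∈ A, ∀ s : Fin 4, I.vars j s ∈ P) (hBP : ∀ j ∈ B, ∀ s : Fin 4, I.vars j s ∉ P)
    {e : Fin m} (he : e ∈ A) :
    ∃ w : Fin n → Bool, (∀ j ∈ B, I.eval w j = y j) ∧ (∀ j ∈ A.erase e, I.eval w j = y j) ∧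
      let D₁ : Finset (Fin n) × Finset (Fin m) := ((w₁.1.filter (· ∈ P)) ∆ litSetAt I P w₁.2.1 w, gin I P w₁.2.1)
      let D₂ : Finset (Fin n) × Finset (Fin m) := ((w₂.1.filter (· ∈ P)) ∆ litSetAt I P w₂.2.1 w, gin I P w₂.2.1)
      let β₁ : Bool := xor w₁.2.2 (gval I (w₁.1.filter (· ∉ P)) (gout I P w₁.2.1) w)
      let β₂ : Bool := xor w₂.2.2 (gval I (w₂.1.filter (· ∉ P)) (gout I P w₂.2.1) w)
      (gval I D₁.1 D₁.2 w = β₁ ∧ gval I D₂.1 D₂.2 w = β₂) ∧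
      (¬ ∃ z : Fin n → Bool, (∀ j ∈ A, I.eval z j = y j) ∧ gval I D₁.1 D₁.2 z = β₁ ∧ gval I D₂.1 D₂.2 z = β₂) ∧
      (∃ z : Fin n → Bool, (∀ j ∈ A, I.eval z j = y j) ∧ gval I D₁.1 D₁.2 z = β₁) ∧
      (∃ z : Fin n → Bool, (∀ j ∈ A, I.eval z j = y j) ∧ gval I D₂.1 D₂.2 z = β₂) ∧
      (∃ z : Fin n → Bool, (∀ j ∈ A, I.eval z j = y j) ∧ xor (gval I D₁.1 D₁.2 z) (gval I D₂.1 D₂.2 z) = xor β₁ β₂) := by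
  classical
  obtain ⟨-, -, hKr, hd₁, hd₂, -, hT3, hM0⟩ := ht
  have hAK : A ⊆ K := by rw [← hAB]; exact subset_union_left
  have hBK : B ⊆ K := by rw [← hAB]; exact subset_union_right
  have hAr : A.card ≤ r := (card_le_card hAK).trans hKr.le
  have hAB' : ∀ j ∈ A, j ∉ B := fun j hjA hjB => hBP j hjB 0 (hAP j hjA 0)
  obtain ⟨w, hw', hw₁, hw₂⟩ := hM0 e (hAK he)
  have hwB : ∀ j ∈ B, I.eval w j = y j := fun j hj => hw' j (mem_erase.2 ⟨fun h => hAB' e he (h ▸ hj), hBK hj⟩)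
  have hwA : ∀ j ∈ A.erase e, I.eval w j = y j := fun j hj => hw' j (mem_erase.2 ⟨ne_of_mem_erase hj, hAK (mem_of_mem_erase hj)⟩)
  refine ⟨w, hwB, hwA, ?_⟩
  intro D₁ D₂ β₁ β₂
  -- the fibre readers at a glued point
  have key₁ : ∀ z, gval I w₁.1 w₁.2.1 (P.piecewise z w) = xor (gval I D₁.1 D₁.2 z) (gval I (w₁.1.filter (· ∉ P)) (gout I P w₁.2.1) w) := by
    intro z
    rw [gval_piecewise, show gval I D₁.1 D₁.2 z = _ from gval_fibre I P w₁.1 w₁.2.1 w z]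
    cases gval I (w₁.1.filter (· ∈ P)) (gin I P w₁.2.1) z <;> cases gval I (w₁.1.filter (· ∉ P)) (gout I P w₁.2.1) w <;>
      cases parity (litSetAt I P w₁.2.1 w) z <;> rfl
  have key₂ : ∀ z, gval I w₂.1 w₂.2.1 (P.piecewise z w) = xor (gval I D₂.1 D₂.2 z) (gval I (w₂.1.filter (· ∉ P)) (gout I P w₂.2.1) w) := by
    intro z
    rw [gval_piecewise, show gval I D₂.1 D₂.2 z = _ from gval_fibre I P w₂.1 w₂.2.1 w z]
    cases gval I (w₂.1.filter (· ∈ P)) (gin I P w₂.2.1) z <;> cases gval I (w₂.1.filter (· ∉ P)) (gout I P w₂.2.1) w <;>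
      cases parity (litSetAt I P w₂.2.1 w) z <;> rfl
  -- gluing solves `A` from `z` and `B` from `w`
  have glueA : ∀ z, (∀ j ∈ A, I.eval z j = y j) → ∀ j ∈ A, I.eval (P.piecewise z w) j = y j := by
    intro z hz j hj
    rw [eval_congr I hI (z' := z) fun s => Finset.piecewise_eq_of_mem _ _ _ (hAP j hj s)]
    exact hz j hj
  have glueB : ∀ z, ∀ j ∈ B, I.eval (P.piecewise z w) j = y j := by
    intro z j hj
    rw [eval_congr I hI (z' := w) fun s => Finset.piecewise_eq_of_notMem _ _ _ (hBP j hj s)]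
    exact hwB j hj
  -- (M0) for `e` on the fibre: `w` itself
  have hself : P.piecewise w w = w := funext fun v => by
    by_cases hv : v ∈ P
    · exact Finset.piecewise_eq_of_mem _ _ _ hv
    · exact Finset.piecewise_eq_of_notMem _ _ _ hv
  have on₁ : gval I D₁.1 D₁.2 w = β₁ := by
    have h := key₁ w
    rw [hself, hw₁] at h
    change gval I D₁.1 D₁.2 w = xor w₁.2.2 (gval I (w₁.1.filter (· ∉ P)) (gout I P w₁.2.1) w)
    revert h; cases gval I D₁.1 D₁.2 w <;> cases w₁.2.2 <;> cases gval I (w₁.1.filter (· ∉ P)) (gout I P w₁.2.1) w <;> decide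
  have on₂ : gval I D₂.1 D₂.2 w = β₂ := by
    have h := key₂ w
    rw [hself, hw₂] at h
    change gval I D₂.1 D₂.2 w = xor w₂.2.2 (gval I (w₂.1.filter (· ∉ P)) (gout I P w₂.2.1) w)
    revert h; cases gval I D₂.1 D₂.2 w <;> cases w₂.2.2 <;> cases gval I (w₂.1.filter (· ∉ P)) (gout I P w₂.2.1) w <;> decide
  -- (T3) on the fibre
  have T3 : ¬ ∃ z : Fin n → Bool, (∀ j ∈ A, I.eval z j = y j) ∧ gval I D₁.1 D₁.2 z = β₁ ∧ gval I D₂.1 D₂.2 z = β₂ := by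
    rintro ⟨z, hzA, h₁, h₂⟩
    refine hT3 ⟨P.piecewise z w, fun j hj => ?_, ?_, ?_⟩
    · rw [← hAB, mem_union] at hj
      rcases hj with hj | hj
      · exact glueA z hzA j hj
      · exact glueB z j hj
    · rw [key₁, h₁]
      change xor (xor w₁.2.2 (gval I (w₁.1.filter (· ∉ P)) (gout I P w₁.2.1) w)) (gval I (w₁.1.filter (· ∉ P)) (gout I P w₁.2.1) w) = w₁.2.2
      cases w₁.2.2 <;> cases gval I (w₁.1.filter (· ∉ P)) (gout I P w₁.2.1) w <;> rfl
    · rw [key₂, h₂]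
      change xor (xor w₂.2.2 (gval I (w₂.1.filter (· ∉ P)) (gout I P w₂.2.1) w)) (gval I (w₂.1.filter (· ∉ P)) (gout I P w₂.2.1) w) = w₂.2.2
      cases w₂.2.2 <;> cases gval I (w₂.1.filter (· ∉ P)) (gout I P w₂.2.1) w <;> rfl
  -- the three combinations attain their targets on `Sol(A)` (Lemma S over `A`, against `w`)
  have hd : Disjoint K (w₁.2.1 ∪ w₂.2.1) := disjoint_union_right.2 ⟨hd₁, hd₂⟩
  have dA₁ : Disjoint A D₁.2 := (hd.mono_left hAK).mono_right ((gin_subset I P _).trans subset_union_left)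
  have dA₂ : Disjoint A D₂.2 := (hd.mono_left hAK).mono_right ((gin_subset I P _).trans subset_union_right)
  have dA₁₂ : Disjoint A (D₁.2 ∆ D₂.2) := (hd.mono_left hAK).mono_right
    ((symmDiff_subset_union' _ _).trans (union_subset ((gin_subset I P _).trans subset_union_left) ((gin_subset I P _).trans subset_union_right)))
  refine ⟨⟨on₁, on₂⟩, T3, ?_, ?_, ?_⟩
  · by_contra h
    push Not at h
    exact gval_ne_of_ne_on_sol I hI hT hS hB y hAr dA₁ (c := β₁) h w on₁
  · by_contra h
    push Not at h
    exact gval_ne_of_ne_on_sol I hI hT hS hB y hAr dA₂ (c := β₂) h w on₂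
  · by_contra h
    push Not at h
    refine gval_ne_of_ne_on_sol I hI hT hS hB y hAr dA₁₂ (c := xor β₁ β₂) (fun z hz => by rw [gval_symmDiff]; exact h z hz) w ?_
    rw [gval_symmDiff, on₁, on₂]

end Summit.PneNP.PneNP.Theorems.PstarSplitFibre
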